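import Literature.AnabelianGeometry.EtaleTheta.ContH1
import Literature.NumberTheory.GaloisRepresentations.ContinuousH1
import HarnessLib

/-!
# [EtTh] §1 support: the continuous `H¹` of `ContH1.lean` IS Mathlib's `continuousCohomology 1`

Bridge / dedup file of the abc-iut cell (layer L2, [EtTh]; seat abc-iut-L2-t12, unit W2-L2-08 (c)).
The tree carries two CONTINUOUS first cohomology groups:

* `ContH1 φ A H` (`EtaleTheta/ContH1.lean`, abc-iut-L2-t1): continuous crossed homomorphisms
  `H → A` into an abelian normal subgroup `A ≤ G'` of a topological group `G'`, a subgroup `H ≤ G`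
  acting by conjugation THROUGH `φ : G →* G'`, modulo principal ones — the carrier of every class
  of [EtTh] §§1–2 ("the [continuous] group cohomology of the tempered fundamental group",
  PRIMS PDF p. 11 [cite: MochizukiEtTh2009, §1 p.11]; `η̈^Θ`, the Kummer classes, `log(Θ)`), and of
  the monoid Kummer maps of `AbsoluteAnabelian/MonoidKummerMaps.lean`;
* Mathlib's `continuousCohomology 1 X` for `X : TopRep ℤ H` (homology of the homogeneous
  continuous cochain complex) — the carrier layer L4 uses for `H¹(Π_U, M_X)`
  (`AbsTopIII/CuspidalCyclotome.lean`, `GeometricCyclotomeModule.lean`), with the element-level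
  degree-`1` API of `Literature/NumberTheory/GaloisRepresentations/ContinuousH1.lean`
  (`contOneCocycles`, `oneCocycleClass`: additive, surjective, kernel = principal crossed
  homomorphisms, `map_oneCocycleClass`).

`ContH1.lean` records "TODO-merge(Mathlib): bridge to `ContCohomology` in degree 1". This file
IS that bridge ([cite: NeukirchSchmidtWingberg2008, I §2 and II §7]: `H¹` of continuous
homogeneous cochains = continuous crossed homomorphisms modulo principal ones; the same statement
is [cite: SerreGaloisCohomology1997, I §2.3]):

* `conjCLM A g'`, `conjContRep φ A H`, `conjTopRep φ A H` — the coefficient group `Additive ↥A`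
  as a topological `ℤ[H]`-module, `h` acting by conjugation by `φ h` (an object of `TopRep ℤ ↥H`);
* `toContOneCocycle` / `ofContOneCocycle` / `cocyclesEquiv` — a continuous cocycle of `ContH1.lean`
  is literally (via `Additive.ofMul`) a continuous crossed homomorphism of `conjTopRep φ A H`;
* `ContH1.toContinuousCohomology : ContH1 φ A H →* Multiplicative (continuousCohomology 1 _)`,
  `[f] ↦ [f]`, PROVED injective and surjective; packaged as the group isomorphism
  `ContH1.continuousCohomologyEquiv`;
* compatibilities with Mathlib's functoriality `ContinuousCohomology.map` (each an explicit
  compatible pair): restriction along `H₁ ≤ H₂` (`toContinuousCohomology_res`), the pull-back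
  `ContH1.infl` along a continuous `ψ : G₀ → G'` (`toContinuousCohomology_infl`), and the
  conjugation action `ContH1.conj σ` (`toContinuousCohomology_conj`).

Consequence: every [EtTh] class is, kernel-checked, an element of the same `H¹` as [AbsTopIII]'s,
and the `continuousCohomology` library of `Literature/NumberTheory/GaloisRepresentations/*` applies
to `ContH1`. Universe note: Mathlib's `resolutionX` forces the group and the coefficients into ONE
universe, so `G G' G₀ : Type u` here (every [EtTh] instance lives in `Type`). Generic homological
algebra; no anabelian content; nothing of [EtTh] is asserted.
-/

noncomputable section

namespace Literature.AnabelianGeometry.EtaleTheta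

open CategoryTheory TopRep ContRepresentation Literature.NumberTheory.GaloisRepresentations

universe u

-- Mathlib's scoped instance `[Group G] [IsMulCommutative G] : CommGroup G` (as in `ContH1.lean`):
-- `A` is a `CommGroup`, so `Additive ↥A` is an `AddCommGroup` = a `ℤ`-module (subspace topology).
open scoped IsMulCommutative

/-! ### The coefficient subgroup as a topological `ℤ[H]`-module -/

section Coefficients

variable {G G' : Type u} [Group G] [Group G'] [TopologicalSpace G'] [IsTopologicalGroup G']
  (φ : G →* G') (A : Subgroup G') [A.Normal] [IsMulCommutative A] (H : Subgroup G)

/-- Conjugation by `g' ∈ G'` on the abelian normal subgroup `A`, as a continuous `ℤ`-linear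
endomorphism of `Additive ↥A`. [cite: NeukirchSchmidtWingberg2008, I §2 and II §7] -/
def conjCLM (g' : G') : Additive A →L[ℤ] Additive A where
  toLinearMap := (MonoidHom.toAdditive ((MulAut.conjNormal g' : MulAut A) : A →* A)).toIntLinearMap
  cont := by
    refine continuous_induced_rng.2 ?_
    have : Continuous fun a : A => (g' * (a : G') * g'⁻¹) := by fun_prop
    exact this

/-- `conjCLM A g' a = g' a g'⁻¹` (transported through `Additive`). [cite: NeukirchSchmidtWingberg2008, I §2 and II §7] -/
@[simp] theorem conjCLM_apply (g' : G') (a : Additive A) :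
    conjCLM A g' a = Additive.ofMul (α := A) (MulAut.conjNormal g' (Additive.toMul (α := A) a)) :=
  rfl

/-- The continuous `ℤ`-linear representation of `H` on `Additive ↥A`: `h` acts by conjugation by
`φ h`. [cite: NeukirchSchmidtWingberg2008, I §2 and II §7] -/
def conjContRep : ContRepresentation ℤ H (Additive A) :=
  ContRepresentation.ofMonoidHom
    { toFun := fun h => conjCLM A (φ (h : G))
      map_one' := by
        ext a
        simp
      map_mul' := fun h₁ h₂ => by
        ext a
        simp }

/-- The coefficient module `Additive ↥A` with the conjugation action through `φ`, as an object of
Mathlib's `TopRep ℤ ↥H`. [cite: NeukirchSchmidtWingberg2008, I §2 and II §7] -/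
abbrev conjTopRep : TopRep.{u} ℤ H := TopRep.of (conjContRep φ A H)

/-- The action of `conjTopRep φ A H`, unfolded. [cite: NeukirchSchmidtWingberg2008, I §2 and II §7] -/
@[simp] theorem conjTopRep_ρ_apply (h : H) (a : Additive A) :
    (conjTopRep φ A H).ρ h a =
      Additive.ofMul (α := A) (MulAut.conjNormal (φ (h : G)) (Additive.toMul (α := A) a)) :=
  rfl

/-! ### Cocycles: `contCocycles φ A H` = `contOneCocycles (conjTopRep φ A H)` -/

variable [TopologicalSpace G]

/-- A continuous cocycle of `ContH1.lean` (`f (g h) = f g · φ(g) f(h) φ(g)⁻¹`) is a continuous crossed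
homomorphism of the topological module `conjTopRep φ A H` (`f (g h) = f g + g • f h`).
[cite: NeukirchSchmidtWingberg2008, I §2 and II §7] -/
def toContOneCocycle (f : contCocycles φ A H) : contOneCocycles (conjTopRep φ A H) :=
  ⟨⟨fun h => Additive.ofMul (α := A) (f.1 h), continuous_ofMul.comp f.2.1⟩, fun g h => by
    change Additive.ofMul (α := A) (f.1 (g * h)) = Additive.ofMul (α := A) (f.1 g) +
      Additive.ofMul (α := A) (MulAut.conjNormal (φ (g : G))
        (Additive.toMul (α := A) (Additive.ofMul (α := A) (f.1 h))))
    rw [f.2.2 g h, ofMul_mul]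
    rfl⟩

/-- `toContOneCocycle f h = f h`. [cite: NeukirchSchmidtWingberg2008, I §2 and II §7] -/
@[simp] theorem toContOneCocycle_apply (f : contCocycles φ A H) (h : H) :
    (toContOneCocycle φ A H f).1 h = Additive.ofMul (α := A) (f.1 h) := rfl

/-- Conversely, a continuous crossed homomorphism of `conjTopRep φ A H` is a continuous cocycle of
`ContH1.lean`. [cite: NeukirchSchmidtWingberg2008, I §2 and II §7] -/
def ofContOneCocycle (c : contOneCocycles (conjTopRep φ A H)) : contCocycles φ A H :=
  ⟨fun h => Additive.toMul (α := A) (c.1 h), continuous_toMul.comp c.1.continuous, fun g h => by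
    apply (Additive.ofMul (α := A)).injective
    change c.1 (g * h) = c.1 g + (conjTopRep φ A H).ρ g (c.1 h)
    exact c.2 g h⟩

/-- `ofContOneCocycle c h = c h`. [cite: NeukirchSchmidtWingberg2008, I §2 and II §7] -/
@[simp] theorem ofContOneCocycle_apply (c : contOneCocycles (conjTopRep φ A H)) (h : H) :
    (ofContOneCocycle φ A H c).1 h = Additive.toMul (α := A) (c.1 h) := rfl

/-- The two dictionaries are inverse bijections: continuous cocycles of `ContH1.lean` ≃ continuous
crossed homomorphisms of `conjTopRep φ A H`. [cite: NeukirchSchmidtWingberg2008, I §2 and II §7] -/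
def cocyclesEquiv : contCocycles φ A H ≃* Multiplicative (contOneCocycles (conjTopRep φ A H)) where
  toFun f := Multiplicative.ofAdd (toContOneCocycle φ A H f)
  invFun c := ofContOneCocycle φ A H (Multiplicative.toAdd c)
  left_inv f := rfl
  right_inv c := rfl
  map_mul' f g := by
    rw [← ofAdd_add]
    rfl

/-- A principal crossed homomorphism of `ContH1.lean`, `h ↦ (φ(h) a φ(h)⁻¹) a⁻¹`, read in
`conjTopRep φ A H` is `h ↦ h • a - a`. [cite: NeukirchSchmidtWingberg2008, I §2 and II §7] -/
theorem toContOneCocycle_apply_of_mem_contCoboundaries {f : contCocycles φ A H} {a : A}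
    (ha : f.1 = fun h : H => MulAut.conjNormal (φ (h : G)) a * a⁻¹) (h : H) :
    (toContOneCocycle φ A H f).1 h =
      (conjTopRep φ A H).ρ h (Additive.ofMul (α := A) a) - Additive.ofMul (α := A) a := by
  rw [toContOneCocycle_apply, congrFun ha h, ofMul_mul, ofMul_inv, ← sub_eq_add_neg]
  rfl

/-! ### The comparison on `H¹` -/

variable [IsTopologicalGroup G]

/-- **The comparison map** `ContH1 φ A H → H¹_cont(H, Additive ↥A)` into Mathlib's continuous
cohomology of `conjTopRep φ A H`: `[f] ↦ [f]` (well defined: principal crossed homomorphisms have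
zero class, `oneCocycleClass_eq_zero_iff`). [cite: NeukirchSchmidtWingberg2008, I §2 and II §7] -/
def ContH1.toContinuousCohomology :
    ContH1 φ A H →* Multiplicative (continuousCohomology 1 (conjTopRep φ A H)) :=
  QuotientGroup.lift _
    (MonoidHom.mk'
      (fun f : contCocycles φ A H =>
        Multiplicative.ofAdd (oneCocycleClass (conjTopRep φ A H) (toContOneCocycle φ A H f)))
      fun f₁ f₂ => by
        rw [← ofAdd_add, ← oneCocycleClass_add]
        rfl)
    (by
      rintro f hf
      obtain ⟨a, ha⟩ := (mem_contCoboundaries_iff _).mp (Subgroup.mem_subgroupOf.mp hf)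
      rw [MonoidHom.mem_ker, MonoidHom.mk'_apply, ← ofAdd_zero]
      congr 1
      exact (oneCocycleClass_eq_zero_iff _ _).2
        ⟨Additive.ofMul (α := A) a, toContOneCocycle_apply_of_mem_contCoboundaries φ A H ha⟩)

/-- `toContinuousCohomology [f] = [f]`. [cite: NeukirchSchmidtWingberg2008, I §2 and II §7] -/
theorem ContH1.toContinuousCohomology_mk (f : H → A) (hf : f ∈ contCocycles φ A H) :
    ContH1.toContinuousCohomology φ A H (ContH1.mk f hf) = Multiplicative.ofAdd
      (oneCocycleClass (conjTopRep φ A H) (toContOneCocycle φ A H ⟨f, hf⟩)) :=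
  rfl

/-- **Injectivity**: a continuous cocycle whose class in Mathlib's `H¹` vanishes is `h ↦ h • a - a`
(`oneCocycleClass_eq_zero_iff`), the principal crossed homomorphism of `a`: trivial in `ContH1`.
[cite: NeukirchSchmidtWingberg2008, I §2 and II §7] -/
theorem ContH1.toContinuousCohomology_injective :
    Function.Injective (ContH1.toContinuousCohomology φ A H) := by
  refine (injective_iff_map_eq_one _).2 fun x hx => ?_
  induction x using QuotientGroup.induction_on with
  | H f =>
    change Multiplicative.ofAdd
        (oneCocycleClass (conjTopRep φ A H) (toContOneCocycle φ A H f)) = Multiplicative.ofAdd 0 at hx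
    obtain ⟨v, hv⟩ := (oneCocycleClass_eq_zero_iff _ _).1 (Multiplicative.ofAdd.injective hx)
    refine (QuotientGroup.eq_one_iff _).2 (Subgroup.mem_subgroupOf.2
      ((mem_contCoboundaries_iff _).2 ⟨Additive.toMul (α := A) v, funext fun h => ?_⟩))
    apply (Additive.ofMul (α := A)).injective
    rw [← toContOneCocycle_apply, hv h, ofMul_mul, ofMul_inv, ← sub_eq_add_neg]
    rfl

/-- **Surjectivity**: every class of Mathlib's `H¹_cont(H, Additive ↥A)` is the class of a
continuous crossed homomorphism (`oneCocycleClass_surjective`), hence of a cocycle of `ContH1.lean`.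
[cite: NeukirchSchmidtWingberg2008, I §2 and II §7] -/
theorem ContH1.toContinuousCohomology_surjective :
    Function.Surjective (ContH1.toContinuousCohomology φ A H) := by
  intro γ
  obtain ⟨c, hc⟩ := oneCocycleClass_surjective (conjTopRep φ A H) (Multiplicative.toAdd γ)
  refine ⟨ContH1.mk (ofContOneCocycle φ A H c).1 (ofContOneCocycle φ A H c).2, ?_⟩
  rw [ContH1.toContinuousCohomology_mk]
  apply Multiplicative.toAdd.injective
  rw [toAdd_ofAdd, ← hc]
  rfl

/-- **`ContH1 φ A H ≅ H¹_cont(H, Additive ↥A)`**: the continuous `H¹` of `ContH1.lean` IS, as a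
group, Mathlib's `continuousCohomology 1` of the conjugation module (homogeneous-cochain cohomology
= crossed homomorphisms modulo principal ones). [cite: NeukirchSchmidtWingberg2008, I §2 and II §7] -/
def ContH1.continuousCohomologyEquiv :
    ContH1 φ A H ≃* Multiplicative (continuousCohomology 1 (conjTopRep φ A H)) :=
  MulEquiv.ofBijective (ContH1.toContinuousCohomology φ A H)
    ⟨ContH1.toContinuousCohomology_injective φ A H, ContH1.toContinuousCohomology_surjective φ A H⟩

/-- The isomorphism is the comparison map. [cite: NeukirchSchmidtWingberg2008, I §2 and II §7] -/
@[simp] theorem ContH1.continuousCohomologyEquiv_apply (x : ContH1 φ A H) :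
    ContH1.continuousCohomologyEquiv φ A H x = ContH1.toContinuousCohomology φ A H x := rfl

end Coefficients

/-! ### Compatibility with Mathlib's functoriality: restriction -/

section Restriction

variable {G G' : Type u} [Group G] [TopologicalSpace G]
  [Group G'] [TopologicalSpace G'] [IsTopologicalGroup G']
  (φ : G →* G') (A : Subgroup G') [A.Normal] [IsMulCommutative A] {H₁ H₂ : Subgroup G} (h : H₁ ≤ H₂)

/-- The inclusion `H₁ ≤ H₂` as a continuous homomorphism. [cite: NeukirchSchmidtWingberg2008, I §2 and II §7] -/
def inclusionₜ : H₁ →ₜ* H₂ where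
  toMonoidHom := Subgroup.inclusion h
  continuous_toFun := continuous_inclusion h

/-- `inclusionₜ h x = x`. [cite: NeukirchSchmidtWingberg2008, I §2 and II §7] -/
@[simp] theorem inclusionₜ_apply (x : H₁) : inclusionₜ h x = Subgroup.inclusion h x := rfl

/-- The compatible pair for restriction: on coefficients it is the identity of `Additive ↥A`
(`H₁` acts through `φ` on both sides). [cite: NeukirchSchmidtWingberg2008, I §2 and II §7] -/
def resHom : TopRep.res (inclusionₜ h : H₁ →* H₂) (conjTopRep φ A H₂) ⟶ conjTopRep φ A H₁ :=
  TopRep.ofHom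
    { toLinearMap := LinearMap.id
      cont := continuous_id
      isIntertwining' := fun x => by ext a; rfl }

/-- `resHom` is the identity on elements. [cite: NeukirchSchmidtWingberg2008, I §2 and II §7] -/
@[simp] theorem resHom_apply (a : Additive A) : (resHom φ A h).hom a = a := rfl

variable [IsTopologicalGroup G]

/-- **Restriction is restriction**: `ContH1.res` corresponds, under the comparison maps, to
Mathlib's `ContinuousCohomology.map` of the pair (inclusion `H₁ → H₂`, identity).
[cite: NeukirchSchmidtWingberg2008, I §2 and II §7] -/
theorem ContH1.toContinuousCohomology_res (x : ContH1 φ A H₂) :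
    ContH1.toContinuousCohomology φ A H₁ (ContH1.res φ A h x) = Multiplicative.ofAdd
      (ContinuousCohomology.map (inclusionₜ h) (resHom φ A h) 1
        (Multiplicative.toAdd (ContH1.toContinuousCohomology φ A H₂ x))) := by
  induction x using QuotientGroup.induction_on with
  | H f =>
    change Multiplicative.ofAdd (oneCocycleClass (conjTopRep φ A H₁)
        (toContOneCocycle φ A H₁ (ContH1.resCocycle φ A h f))) =
      Multiplicative.ofAdd (ContinuousCohomology.map (inclusionₜ h) (resHom φ A h) 1
        (oneCocycleClass (conjTopRep φ A H₂) (toContOneCocycle φ A H₂ f)))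
    rw [map_oneCocycleClass]
    congr 2

end Restriction

/-! ### Compatibility with Mathlib's functoriality: inflation / pull-back along `ψ : G₀ → G'` -/

section Inflation

variable {G' : Type u} [Group G'] [TopologicalSpace G'] [IsTopologicalGroup G']
  (A : Subgroup G') [A.Normal] [IsMulCommutative A]
  {G₀ : Type u} [Group G₀] [TopologicalSpace G₀]
  (ψ : G₀ →* G') (hψ : Continuous ψ) {H₀ : Subgroup G₀} {H' : Subgroup G'} (h : H₀.map ψ ≤ H')

omit [IsTopologicalGroup G'] in
/-- `ψ` restricted to `H₀ → H'`, as a continuous homomorphism. [cite: NeukirchSchmidtWingberg2008, I §2 and II §7] -/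
def restrictₜ : H₀ →ₜ* H' where
  toMonoidHom := (ψ.restrict H₀).codRestrict H' fun x => h ⟨x.1, x.2, rfl⟩
  continuous_toFun := ((hψ.comp continuous_subtype_val).subtype_mk _)

omit [IsTopologicalGroup G'] in
/-- `restrictₜ ψ hψ h x = ψ x`. [cite: NeukirchSchmidtWingberg2008, I §2 and II §7] -/
@[simp] theorem coe_restrictₜ_apply (x : H₀) : ((restrictₜ ψ hψ h x : H') : G') = ψ x := rfl

/-- The compatible pair for `ContH1.infl`: on coefficients it is the identity of `Additive ↥A`
(`x ∈ H₀` acts by conjugation by `ψ x` on both sides). [cite: NeukirchSchmidtWingberg2008, I §2 and II §7] -/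
def inflHom : TopRep.res (restrictₜ ψ hψ h : H₀ →* H') (conjTopRep (MonoidHom.id G') A H') ⟶
    conjTopRep ψ A H₀ :=
  TopRep.ofHom
    { toLinearMap := LinearMap.id
      cont := continuous_id
      isIntertwining' := fun x => by ext a; rfl }

/-- `inflHom` is the identity on elements. [cite: NeukirchSchmidtWingberg2008, I §2 and II §7] -/
@[simp] theorem inflHom_apply (a : Additive A) : (inflHom A ψ hψ h).hom a = a := rfl

variable [IsTopologicalGroup G₀]

/-- **Inflation is inflation**: `ContH1.infl` (pull-back along a continuous `ψ : G₀ → G'` with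
`ψ(H₀) ≤ H'`, e.g. `Π^tp_Ÿ → (Π^tp_Ÿ)^Θ` in [EtTh] Prop. 1.5 (iii)) corresponds, under the comparison
maps, to Mathlib's `ContinuousCohomology.map` of the pair (`ψ| : H₀ → H'`, identity).
[cite: NeukirchSchmidtWingberg2008, I §2 and II §7] -/
theorem ContH1.toContinuousCohomology_infl (x : ContH1 (MonoidHom.id G') A H') :
    ContH1.toContinuousCohomology ψ A H₀ (ContH1.infl A ψ hψ h x) = Multiplicative.ofAdd
      (ContinuousCohomology.map (restrictₜ ψ hψ h) (inflHom A ψ hψ h) 1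
        (Multiplicative.toAdd (ContH1.toContinuousCohomology (MonoidHom.id G') A H' x))) := by
  induction x using QuotientGroup.induction_on with
  | H f =>
    change Multiplicative.ofAdd (oneCocycleClass (conjTopRep ψ A H₀)
        (toContOneCocycle ψ A H₀ (ContH1.inflCocycle A ψ hψ h f))) =
      Multiplicative.ofAdd (ContinuousCohomology.map (restrictₜ ψ hψ h) (inflHom A ψ hψ h) 1
        (oneCocycleClass (conjTopRep (MonoidHom.id G') A H') (toContOneCocycle _ A H' f)))
    rw [map_oneCocycleClass]
    congr 2

end Inflation

/-! ### Compatibility with Mathlib's functoriality: the conjugation action -/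

section Conjugation

variable {G G' : Type u} [Group G] [TopologicalSpace G] [IsTopologicalGroup G]
  [Group G'] [TopologicalSpace G'] [IsTopologicalGroup G']
  (φ : G →* G') (A : Subgroup G') [A.Normal] [IsMulCommutative A] (H : Subgroup G) [H.Normal]
  (σ : G)

/-- Conjugation `x ↦ σ⁻¹ x σ` on the normal subgroup `H`, as a continuous homomorphism.
[cite: NeukirchSchmidtWingberg2008, I §2 and II §7] -/
def conjₜ : H →ₜ* H where
  toMonoidHom := (MulAut.conjNormal σ⁻¹ : MulAut H).toMonoidHom
  continuous_toFun := by
    refine continuous_induced_rng.2 ?_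
    have : Continuous fun x : H => (σ⁻¹ * (x : G) * σ⁻¹⁻¹) := by fun_prop
    exact this

/-- `conjₜ σ x = σ⁻¹ x σ`. [cite: NeukirchSchmidtWingberg2008, I §2 and II §7] -/
@[simp] theorem conjₜ_apply (x : H) : conjₜ H σ x = MulAut.conjNormal σ⁻¹ x := rfl

omit [TopologicalSpace G] [IsTopologicalGroup G] [TopologicalSpace G'] [IsTopologicalGroup G']
  [IsMulCommutative A] in
/-- The conjugation identity behind the compatible pair: `φ(σ)·(φ(σ⁻¹xσ)·a) = φ(x)·(φ(σ)·a)`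
(`·` = conjugation). [cite: NeukirchSchmidtWingberg2008, I §2 and II §7] -/
theorem conjNormal_conj_comm (x : H) (a : A) :
    MulAut.conjNormal (φ σ) (MulAut.conjNormal (φ ((MulAut.conjNormal σ⁻¹ x : H) : G)) a) =
      MulAut.conjNormal (φ (x : G)) (MulAut.conjNormal (φ σ) a) := by
  apply Subtype.ext
  simp only [MulAut.conjNormal_apply]
  simp only [map_mul, map_inv]
  group

/-- The compatible pair for the conjugation action: on coefficients, `a ↦ φ(σ) a φ(σ)⁻¹`.
[cite: NeukirchSchmidtWingberg2008, I §2 and II §7] -/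
def conjHom : TopRep.res (conjₜ H σ : H →* H) (conjTopRep φ A H) ⟶ conjTopRep φ A H :=
  TopRep.ofHom
    { toLinearMap := (conjCLM A (φ σ)).toLinearMap
      cont := (conjCLM A (φ σ)).cont
      isIntertwining' := fun x => ContinuousLinearMap.ext fun a => by
        change conjCLM A (φ σ) ((conjTopRep φ A H).ρ (conjₜ H σ x) a) =
          (conjTopRep φ A H).ρ x (conjCLM A (φ σ) a)
        rw [conjCLM_apply, conjCLM_apply, conjTopRep_ρ_apply, conjTopRep_ρ_apply, conjₜ_apply]
        exact congrArg (Additive.ofMul (α := A)) (conjNormal_conj_comm φ A H σ x _) }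

/-- `conjHom` on elements. [cite: NeukirchSchmidtWingberg2008, I §2 and II §7] -/
@[simp] theorem conjHom_apply (a : Additive A) :
    (conjHom φ A H σ).hom a = Additive.ofMul (MulAut.conjNormal (φ σ) (Additive.toMul a)) := rfl

/-- **The conjugation action is functoriality**: `ContH1.conj σ` (the action of `σ ∈ G` on
`H¹(H, A)`, `H` normal — e.g. of `Z ≅ Π^tp_X/Π^tp_Y` in [EtTh] Prop. 1.5 (iii)) corresponds, under
the comparison map, to Mathlib's `ContinuousCohomology.map` of the pair (`x ↦ σ⁻¹ x σ`,
`a ↦ φ(σ) a φ(σ)⁻¹`). [cite: NeukirchSchmidtWingberg2008, I §2 and II §7] -/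
theorem ContH1.toContinuousCohomology_conj (x : ContH1 φ A H) :
    ContH1.toContinuousCohomology φ A H (ContH1.conj φ A σ x) = Multiplicative.ofAdd
      (ContinuousCohomology.map (conjₜ H σ) (conjHom φ A H σ) 1
        (Multiplicative.toAdd (ContH1.toContinuousCohomology φ A H x))) := by
  induction x using QuotientGroup.induction_on with
  | H f =>
    change Multiplicative.ofAdd (oneCocycleClass (conjTopRep φ A H)
        (toContOneCocycle φ A H (ContH1.conjCocycle φ A σ f))) =
      Multiplicative.ofAdd (ContinuousCohomology.map (conjₜ H σ) (conjHom φ A H σ) 1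
        (oneCocycleClass (conjTopRep φ A H) (toContOneCocycle φ A H f)))
    rw [map_oneCocycleClass]
    congr 2

end Conjugation

end Literature.AnabelianGeometry.EtaleTheta
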